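import Literature.RingTheory.Etale.FiniteHopfAlgebraReducedQuotient
import Mathlib.FieldTheory.Perfect
import Mathlib.Algebra.CharP.Reduced
import Mathlib.Algebra.CharP.Algebra
import HarnessLib

/-!
# Finite étale algebras over a perfect field are perfect rings ([StacksProject] Tag 00U3, Frobenius form)

Topic `Literature/RingTheory/Etale`; namespace `Literature.RingTheory.Etale`.  PROOF FILE (theorems only; no definition, no named fact,
no instance, no notation, no `sorry`).  Cell `hodgecm-mathlib` (D-0151), FLOOR-0 P5a row G14 (F0P5a-plan (g5) 07:36:43Z ∕ 07:50:24Z):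
the ABSOLUTE-FROBENIUS form of «relative Frobenius is an isomorphism on the étale pieces» (MOD-ROAD-P″ add2 [h0]) — def-free,
road-independent.  Companion of ★ `Etale/FiniteHopfAlgebraReducedQuotient` (universe-polymorphic
`etale_iff_isReduced_of_finite_of_perfectField`: over a perfect field, étale ⇔ reduced; A-p07 (g20) G9).

For a field `k`, a natural number `p` with `[ExpChar k p]`, and a commutative finite-dimensional `k`-algebra `B` with `[ExpChar B p]`:
* **`frobenius_bijective_of_isReduced`** (`k` perfect, `B` reduced) and **`frobenius_bijective_of_etale`** (`k` perfect, `B` étale):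
  the Frobenius `x ↦ x^p` of `B` is BIJECTIVE; `perfectRing_of_etale` — the same as Mathlib `PerfectRing B p`; iterate form
  `iterateFrobenius_bijective_of_etale` (`x ↦ x^(p^f)`).  Proof: injective because `B` is reduced (Mathlib `frobenius_inj`);
  surjective factor-by-factor through Mathlib `IsArtinianRing.equivPi : B ≃ₐ Π_𝔪 B ⧸ 𝔪` (reduced artinian), each residue field
  `B ⧸ 𝔪` being a finite — hence perfect — extension of `k` (Mathlib `Algebra.IsAlgebraic.perfectField`, `PerfectField.toPerfectRing`).
* converse **`isReduced_of_frobenius_injective`** (any commutative ring of exponential characteristic `p`) and the packaging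
  **`etale_iff_frobenius_bijective`** (over a perfect field: étale ⇔ Frobenius bijective ⇔ Frobenius injective,
  `etale_iff_frobenius_injective`).

HC_CM is proved only modulo the 7 printed citations until rung 0 closes; this file is generic commutative algebra and changes no count.

## References
* [StacksProject] The Stacks Project, Tag 00U3 (Algebra, Lemma 10.143.4: étale algebras over a field are finite products of finite
  separable extensions); the statement here is its combination with «a finite (separable) extension of a perfect field is perfect»
  (Mathlib `Algebra.IsAlgebraic.perfectField`) read on the Frobenius.
-/

set_option autoImplicit false

noncomputable section

namespace Literature.RingTheory.Etale

universe u v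

section Perfect

variable (k : Type u) [Field k] (p : ℕ) [ExpChar k p] (B : Type v) [CommRing B] [Algebra k B] [Module.Finite k B]
  [ExpChar B p]

/-- **A reduced finite-dimensional algebra over a perfect field has bijective Frobenius** (`x ↦ x^p`): injective since `B` is
reduced, surjective because `B ≅ Π_𝔪 B ⧸ 𝔪` (reduced artinian) with every `B ⧸ 𝔪` a finite, hence perfect, extension of `k`.
[cite: StacksProject, Tag 00U3] -/
theorem frobenius_bijective_of_isReduced [PerfectField k] [IsReduced B] : Function.Bijective (frobenius B p) := by
  classical
  refine ⟨frobenius_inj B p, fun y => ?_⟩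
  haveI : IsArtinianRing B := IsArtinianRing.of_finite k B
  -- the residue fields are perfect
  have hroot : ∀ (I : MaximalSpectrum B) (z : B ⧸ I.asIdeal), ∃ w : B ⧸ I.asIdeal, w ^ p = z := by
    intro I z
    letI : Field (B ⧸ I.asIdeal) := Ideal.Quotient.field I.asIdeal
    haveI : Module.Finite k (B ⧸ I.asIdeal) :=
      Module.Finite.of_surjective (Ideal.Quotient.mkₐ k I.asIdeal).toLinearMap (Ideal.Quotient.mkₐ_surjective k _)
    haveI : Algebra.IsAlgebraic k (B ⧸ I.asIdeal) := Algebra.IsAlgebraic.of_finite k _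
    haveI : PerfectField (B ⧸ I.asIdeal) := Algebra.IsAlgebraic.perfectField k
    haveI : ExpChar (B ⧸ I.asIdeal) p := expChar_of_injective_algebraMap (algebraMap k (B ⧸ I.asIdeal)).injective p
    obtain ⟨w, hw⟩ := (PerfectField.toPerfectRing (K := B ⧸ I.asIdeal) p).bijective_frobenius.2 z
    exact ⟨w, hw⟩
  -- lift `p`-th roots factor by factor along `B ≃ Π_𝔪 B ⧸ 𝔪`
  set e := IsArtinianRing.equivPi B with he
  choose w hw using fun I => hroot I (e y I)
  refine ⟨e.symm w, ?_⟩
  apply e.injective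
  funext I
  rw [frobenius_def, map_pow, AlgEquiv.apply_symm_apply, Pi.pow_apply, hw]

/-- **A finite ÉTALE algebra over a perfect field is a perfect ring**: its Frobenius `x ↦ x^p` is bijective
(étale ⇒ reduced, ★ `etale_iff_isReduced_of_finite_of_perfectField`). [cite: StacksProject, Tag 00U3] -/
theorem frobenius_bijective_of_etale [PerfectField k] [Algebra.Etale k B] : Function.Bijective (frobenius B p) := by
  haveI : IsReduced B := (etale_iff_isReduced_of_finite_of_perfectField k B).1 ‹Algebra.Etale k B›
  exact frobenius_bijective_of_isReduced k p B

/-- The same, stated as Mathlib's `PerfectRing B p` (a `Prop`; not registered as an instance here).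
[cite: StacksProject, Tag 00U3] -/
theorem perfectRing_of_etale [PerfectField k] [Algebra.Etale k B] : PerfectRing B p :=
  ⟨frobenius_bijective_of_etale k p B⟩

/-- Iterate form: `x ↦ x^(p^f)` is bijective on a finite étale algebra over a perfect field. [cite: StacksProject, Tag 00U3] -/
theorem iterateFrobenius_bijective_of_etale [PerfectField k] [Algebra.Etale k B] (f : ℕ) :
    Function.Bijective (iterateFrobenius B p f) := by
  induction f with
  | zero =>
      have h : (iterateFrobenius B p 0 : B → B) = id := funext fun x => by simp
      rw [h]; exact Function.bijective_id
  | succ f ih =>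
      have h : (iterateFrobenius B p (f + 1) : B → B) = frobenius B p ∘ iterateFrobenius B p f :=
        funext fun x => by simp [iterateFrobenius_def, frobenius_def, pow_succ, pow_mul]
      rw [h]
      exact (frobenius_bijective_of_etale k p B).comp ih

end Perfect

section Converse

variable (B : Type v) [CommRing B] (p : ℕ) [ExpChar B p]

/-- The iterates of an injective Frobenius are injective. [cite: StacksProject, Tag 00U3] -/
theorem iterateFrobenius_injective_of_frobenius_injective (h : Function.Injective (frobenius B p)) (m : ℕ) :
    Function.Injective (iterateFrobenius B p m) := by
  induction m with
  | zero =>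
      have h0 : (iterateFrobenius B p 0 : B → B) = id := funext fun x => by simp
      rw [h0]; exact Function.injective_id
  | succ m ih =>
      have hs : (iterateFrobenius B p (m + 1) : B → B) = frobenius B p ∘ iterateFrobenius B p m :=
        funext fun x => by simp [iterateFrobenius_def, frobenius_def, pow_succ, pow_mul]
      rw [hs]; exact h.comp ih

/-- **Injective Frobenius forces reducedness** (commutative ring of PRIME characteristic exponent `p`; for `p = 1`, i.e.
characteristic `0`, the Frobenius is the identity and the statement would be false, e.g. for `k[ε]`): a nilpotent `x` has
`x^(p^n) = 0 = 0^(p^n)`, and `x ↦ x^(p^n)` is injective. [cite: StacksProject, Tag 00U3] -/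
theorem isReduced_of_frobenius_injective (hp : p.Prime) (h : Function.Injective (frobenius B p)) : IsReduced B := by
  refine ⟨fun x hx => ?_⟩
  obtain ⟨n, hn⟩ := hx
  have hle : n ≤ p ^ n := (Nat.lt_pow_self hp.one_lt).le
  have hzero : x ^ p ^ n = 0 := by
    obtain ⟨c, hc⟩ := Nat.exists_eq_add_of_le hle
    rw [hc, pow_add, hn, zero_mul]
  have : iterateFrobenius B p n x = iterateFrobenius B p n 0 := by
    rw [iterateFrobenius_def, iterateFrobenius_def, hzero, zero_pow (pow_ne_zero _ hp.ne_zero)]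
  exact iterateFrobenius_injective_of_frobenius_injective B p h n this

variable (k : Type u) [Field k] [ExpChar k p] [Algebra k B] [Module.Finite k B]

/-- **Over a perfect field of prime characteristic exponent: étale ⇔ Frobenius injective** (⇔ reduced, ★
`etale_iff_isReduced_of_finite_of_perfectField`). [cite: StacksProject, Tag 00U3] -/
theorem etale_iff_frobenius_injective [PerfectField k] (hp : p.Prime) :
    Algebra.Etale k B ↔ Function.Injective (frobenius B p) := by
  constructor
  · intro hB
    exact (frobenius_bijective_of_etale k p B).1
  · intro h
    haveI := isReduced_of_frobenius_injective B p hp h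
    exact (etale_iff_isReduced_of_finite_of_perfectField k B).2 ‹IsReduced B›

/-- **Over a perfect field of prime characteristic exponent: étale ⇔ Frobenius bijective** (finite-dimensional commutative
algebras). [cite: StacksProject, Tag 00U3] -/
theorem etale_iff_frobenius_bijective [PerfectField k] (hp : p.Prime) :
    Algebra.Etale k B ↔ Function.Bijective (frobenius B p) := by
  constructor
  · intro hB
    exact frobenius_bijective_of_etale k p B
  · intro h
    exact (etale_iff_frobenius_injective B p k hp).2 h.1

end Converse

end Literature.RingTheory.Etale

end
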